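import Summits.QuantumFields.BalabanUV.Beta.GAN24.GradientVertexChainKing

/-!
# `BalabanUV.Beta.GAN24.TwoLegChainKing` — binder row G-an2-4 ∕ (CONV-C), route R7, road P2: the ABSTRACT TWO-LEG CHAIN against King's parent —
# `K = Σ_x η^{d+1} Σ_{ij} m(x,i,j)·P(x,i;s)·Q(x,j;s′)` for ANY two fine-leg kernel families `P, Q` with DISPLAYED letters (block decay `C·e^{−δ|ȳ(x)−y|}`
# and a parent law `ρ·e^{−δ|ȳ(x)−y|}`) and a local vertex `m` (bound `B`, transport `εm`): BOTH (CONV-C) CLAUSES by Leibniz under the child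
# sum (instances in `TwoLegChainInstances`)

NOT IN PRINT; OUR PROOF ATTEMPT (unit `b2b-balaban-gan24-p2`, gen 31 = prover-b2b-balaban-gan24-p2-g31-0, road-P2 chair of row G-an2-4;
CRUX TEAM (2) under the ruling «YM REDIRECT TOWARDS THE SUMMIT», 2026-08-21).  HONEST FRAMING (cell contract, verbatim): «discharging
`BetaPertH` makes Bałaban's UV stability UNCONDITIONAL — a real constructive-QFT result; it is NOT the continuum limit and NOT the Clay
problem.»  HONEST DEPENDENCY (verbatim): «continuum YM on T⁴ ⇐ BetaPertH ∧ nine spine estimates (0/9 proved); BetaPertH ⇐ (D1) ∧ (D4) ∧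
CAP+tail; G-an2-4 gates asym, D1 and NE2/3/4.»  ABSOLUTE RULE: nothing printed is a hypothesis; no `def … : Prop`, no `sorry`; [folklore]
finite sums BY NAME over `GradientVertexChainKing` (child sum, two-centre decay sum), gan24-p3-g27's `HkKingOneStep(Sup)` (value legs) and this
lineage's `HkGradientKingRate` (gradient legs).  Which of an1's rows T1–T8 a given `(P, Q, m)` realises is NOT claimed (S1 is an2∕p1's).

## Content (0 sorry; torus model, dimension `d+1 ≥ 1`, every period vector)

 * §1 `chain2 n M P Q m s s′ := Σ_x (n^{d+1})⁻¹ Σ_{i : ι} Σ_{j : κ} m x i j · P x i s · Q x j s′` for finite index types `ι, κ`.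
 * §2 **`norm_chain2_le`** (DECAY): `|P(x,i;y,λ)| ≤ CP·e^{−δ|ȳ(x)−y|}`, `|Q| ≤ CQ·e^{…}`, `|m| ≤ B` ⇒
   `‖K(y,λ;y′,λ′)‖ ≤ |ι|·|κ|·B·CP·CQ·latticeConst(d+1,δ∕2)·e^{−(δ∕2)|y−y′|_T}`.
 * §3 **`norm_chain2_succ_sub_le`** (ONE STEP, general `N, R`): with the same letters at both levels and the PARENT LAWS
   `|P′(x′,i;s) − P(par x′,i;s)| ≤ ρP·e^{−δ|ȳ(x′)−y|}`, `|Q′ − Q∘par| ≤ ρQ·e^{…}`, `|m′ − m∘par| ≤ εm`: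
   `‖K′ − K‖ ≤ |ι|·|κ|·(ρP·B·CQ + CP·εm·CQ + CP·B·ρQ)·latticeConst(d+1,δ∕2)·e^{−(δ∕2)|y−y′|_T}`.
 * INSTANCES (`H_k ⊗ H_k`, `H_k ⊗ ∂H_k`, `∂H_k ⊗ ∂H_k` with constant vertices) are in `TwoLegChainInstances` (the ≤ 400-line rule).
HONEST.  [folklore]; the abstract theorem is pure bookkeeping — all analysis is in the leg letters; U = 1; NOT (CONV-C) as a whole, NEVER
«G-an2-4 closed», NOT NE2, NOT D1, NOT BetaPertH, NOT continuum, NOT Clay.  Text locations only: [King1986] §4 p. 672 (Leibniz mechanism), p. 664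
(parent map); [Balaban1984PropagatorsI] (1.63) p. 28.
-/

noncomputable section

open scoped BigOperators
open Finset

namespace Summit.QuantumFields.BalabanUV.Beta.GAN24.TwoLegChainKing

open Literature.MathematicalPhysics.QuantumFieldTheory.Balaban1983to89
open Literature.MathematicalPhysics.QuantumFieldTheory.Balaban1983to89.B5Prop11Plancherel (Tor fine)
open Literature.MathematicalPhysics.QuantumFieldTheory.Balaban1983to89.B4TorusKernel (periodConst)
open Literature.MathematicalPhysics.QuantumFieldTheory.Balaban1983to89.B4TorusKernel.MultiPeriod (torusSupNorm)
open Literature.MathematicalPhysics.QuantumFieldTheory.Balaban1983to89.B4Sect5Proof (latticeConst latticeConst_nonneg)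
open Literature.MathematicalPhysics.QuantumFieldTheory.Balaban1983to89.B5Block118 (bpt)
open Literature.MathematicalPhysics.QuantumFieldTheory.Balaban1983to89.B5Blocks16 (blockOf)
open Literature.MathematicalPhysics.QuantumFieldTheory.Balaban1983to89.B5Kernel166Decay (periodConst_pos)
open Literature.MathematicalPhysics.QuantumFieldTheory.Balaban1983to89.B6LowerBound2153Torus (toT rep toT_rep)
open Literature.MathematicalPhysics.QuantumFieldTheory.Balaban1983to89.B5G183RateUnitTower (lev lev_neZero)
open Literature.MathematicalPhysics.QuantumFieldTheory.Balaban1983to89.B5Hk163Strip (kappa163 kappa163_pos)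
open Literature.MathematicalPhysics.QuantumFieldTheory.Balaban1983to89.B5Hk163Decay (MG163 MG163_nonneg)
open Literature.MathematicalPhysics.QuantumFieldTheory.Balaban1983to89.B5Hk163Torus (HkOp)
open Literature.MathematicalPhysics.QuantumFieldTheory.Balaban1983to89.B5Hk163TorusHolder (dker)
open Literature.MathematicalPhysics.QuantumFieldTheory.Balaban1983to89.B5Hk163TorusHolderDecay (CdecD CdecD_nonneg)
open Literature.MathematicalPhysics.QuantumFieldTheory.Balaban1983to89.Beta.FluctuationProjection (digitOf bpt_blockOf_digitOf)
open Summit.QuantumFields.BalabanUV.T4Continuum.BalabanAveragedTowerModes (par)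
open Summit.QuantumFields.BalabanUV.T4Continuum.BalabanAveragedTowerUnit (cast_lev')
open Summit.QuantumFields.BalabanUV.Beta.GAN24.HkKingOneStep (dec dec_pos KH1 KH1_nonneg norm_HkOp_bpt_le)
open Summit.QuantumFields.BalabanUV.Beta.GAN24.HkKingOneStepSup (parDigit eq_bpt_and_par_eq norm_HkOp_par_sub_le)
open Summit.QuantumFields.BalabanUV.Beta.GAN24.HkGradientKingRate (thetaG thetaG_pos thetaG_lt_one CG CG_nonneg dec_eq norm_dker_par_sub_le_lev)
open Summit.QuantumFields.BalabanUV.Beta.GAN24.GradientVertexChainKing (sum_blockConst sum_exp_two_centre_le norm_dker_le_block)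
open Summit.QuantumFields.BalabanUV.T4Continuum.BalabanBlockPoincare (tileEquiv)
open Summit.QuantumFields.BalabanUV.T4Continuum.BalabanAveragedTowerModes (par_cpt_add_off)

variable {d : ℕ} {ι κ : Type*} [Fintype ι] [Fintype κ]

/-! ## §1 The abstract two-leg chain -/

section Defs

variable (n : ℕ) [NeZero n] (M : Fin (d + 1) → ℕ) [hM : ∀ μ, NeZero (M μ)]

/-- the unit source type (unit point, component). [folklore] -/
abbrev Src (M : Fin (d + 1) → ℕ) : Type := Tor M × Fin (d + 1)

/-- **THE TWO-LEG CHAIN** `K(s;s′) = Σ_x (n^{d+1})⁻¹ Σ_{i j} m x i j · P x i s · Q x j s′`. [folklore] -/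
def chain2 (P : Tor (fine n M) → ι → Src M → ℂ) (Q : Tor (fine n M) → κ → Src M → ℂ) (m : Tor (fine n M) → ι → κ → ℂ)
    (s s' : Src M) : ℂ :=
  ∑ x : Tor (fine n M), ((((n : ℝ) ^ (d + 1))⁻¹ : ℝ) : ℂ) * ∑ i : ι, ∑ j : κ, m x i j * P x i s * Q x j s'

end Defs

/-! ## §2 The decay clause -/

section Decay

variable (n : ℕ) [NeZero n] (M : Fin (d + 1) → ℕ) [hM : ∀ μ, NeZero (M μ)]

/-- the vertex sum at one fine point. [folklore] -/
theorem norm_vertex_le (P : Tor (fine n M) → ι → Src M → ℂ) (Q : Tor (fine n M) → κ → Src M → ℂ) (m : Tor (fine n M) → ι → κ → ℂ)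
    {B CP CQ δ : ℝ} (hB : 0 ≤ B) (hCP : 0 ≤ CP) (hm : ∀ x i j, ‖m x i j‖ ≤ B) (x : Tor (fine n M)) (y y' : Fin (d + 1) → ℤ)
    (lam lam' : Fin (d + 1))
    (hP : ∀ i, ‖P x i (toT M y, lam)‖ ≤ CP * Real.exp (-(δ * torusSupNorm M (rep M (blockOf n M x) - y))))
    (hQ : ∀ j, ‖Q x j (toT M y', lam')‖ ≤ CQ * Real.exp (-(δ * torusSupNorm M (rep M (blockOf n M x) - y')))) :
    ‖∑ i : ι, ∑ j : κ, m x i j * P x i (toT M y, lam) * Q x j (toT M y', lam')‖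
      ≤ (Fintype.card ι : ℝ) * Fintype.card κ * B * CP * CQ * (Real.exp (-(δ * torusSupNorm M (rep M (blockOf n M x) - y)))
          * Real.exp (-(δ * torusSupNorm M (rep M (blockOf n M x) - y')))) := by
  set E := Real.exp (-(δ * torusSupNorm M (rep M (blockOf n M x) - y)))
  set E' := Real.exp (-(δ * torusSupNorm M (rep M (blockOf n M x) - y')))
  have hterm : ∀ i j, ‖m x i j * P x i (toT M y, lam) * Q x j (toT M y', lam')‖ ≤ B * (CP * E) * (CQ * E') := fun i j => by
    rw [norm_mul, norm_mul]
    exact mul_le_mul (mul_le_mul (hm x i j) (hP i) (norm_nonneg _) hB) (hQ j) (norm_nonneg _)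
      (mul_nonneg hB (mul_nonneg hCP (Real.exp_pos _).le))
  calc _ ≤ ∑ i : ι, ‖∑ j : κ, m x i j * P x i (toT M y, lam) * Q x j (toT M y', lam')‖ := norm_sum_le _ _
    _ ≤ ∑ i : ι, ∑ j : κ, ‖m x i j * P x i (toT M y, lam) * Q x j (toT M y', lam')‖ := Finset.sum_le_sum fun i _ => norm_sum_le _ _
    _ ≤ ∑ _i : ι, ∑ _j : κ, B * (CP * E) * (CQ * E') := Finset.sum_le_sum fun i _ => Finset.sum_le_sum fun j _ => hterm i j
    _ = _ := by simp only [Finset.sum_const, Finset.card_univ, nsmul_eq_mul]; ring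

/-- **THE DECAY CLAUSE OF THE ABSTRACT TWO-LEG CHAIN** (`δ > 0`): block-decaying legs and a bounded vertex give
`‖K(y,λ;y′,λ′)‖ ≤ |ι|·|κ|·B·CP·CQ·latticeConst(d+1, δ∕2)·e^{−(δ∕2)|y−y′|_T}`. [folklore] -/
theorem norm_chain2_le (P : Tor (fine n M) → ι → Src M → ℂ) (Q : Tor (fine n M) → κ → Src M → ℂ) (m : Tor (fine n M) → ι → κ → ℂ)
    {B CP CQ δ : ℝ} (hδ : 0 < δ) (hB : 0 ≤ B) (hCP : 0 ≤ CP) (hCQ : 0 ≤ CQ) (hm : ∀ x i j, ‖m x i j‖ ≤ B)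
    (hP : ∀ x i (y : Fin (d + 1) → ℤ) lam, ‖P x i (toT M y, lam)‖ ≤ CP * Real.exp (-(δ * torusSupNorm M (rep M (blockOf n M x) - y))))
    (hQ : ∀ x j (y : Fin (d + 1) → ℤ) lam, ‖Q x j (toT M y, lam)‖ ≤ CQ * Real.exp (-(δ * torusSupNorm M (rep M (blockOf n M x) - y))))
    (y y' : Fin (d + 1) → ℤ) (lam lam' : Fin (d + 1)) :
    ‖chain2 n M P Q m (toT M y, lam) (toT M y', lam')‖
      ≤ (Fintype.card ι : ℝ) * Fintype.card κ * B * CP * CQ * latticeConst (d + 1) (δ / 2) * Real.exp (-(δ / 2 * torusSupNorm M (y - y'))) := by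
  have hn : (0 : ℝ) < (n : ℝ) ^ (d + 1) := by have := Nat.pos_of_ne_zero (NeZero.ne n); positivity
  have hK : 0 ≤ (Fintype.card ι : ℝ) * Fintype.card κ * B * CP * CQ := by positivity
  unfold chain2
  calc _ ≤ ∑ x : Tor (fine n M), ‖((((n : ℝ) ^ (d + 1))⁻¹ : ℝ) : ℂ) * ∑ i : ι, ∑ j : κ, m x i j * P x i (toT M y, lam) * Q x j (toT M y', lam')‖ :=
        norm_sum_le _ _
    _ ≤ ∑ x : Tor (fine n M), (((n : ℝ) ^ (d + 1))⁻¹) * ((Fintype.card ι : ℝ) * Fintype.card κ * B * CP * CQ *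
          (Real.exp (-(δ * torusSupNorm M (rep M (blockOf n M x) - y))) * Real.exp (-(δ * torusSupNorm M (rep M (blockOf n M x) - y'))))) := by
        refine Finset.sum_le_sum fun x _ => ?_
        rw [norm_mul, Complex.norm_real, Real.norm_of_nonneg (inv_nonneg.mpr hn.le)]
        exact mul_le_mul_of_nonneg_left (norm_vertex_le n M P Q m hB hCP hm x y y' lam lam' (fun i => hP x i y lam) (fun j => hQ x j y' lam'))
          (inv_nonneg.mpr hn.le)
    _ = (Fintype.card ι : ℝ) * Fintype.card κ * B * CP * CQ * ∑ x : Tor (fine n M), (((n : ℝ) ^ (d + 1))⁻¹) *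
          (Real.exp (-(δ * torusSupNorm M (rep M (blockOf n M x) - y))) * Real.exp (-(δ * torusSupNorm M (rep M (blockOf n M x) - y')))) := by
        rw [Finset.mul_sum]; refine Finset.sum_congr rfl fun x _ => ?_; ring
    _ = (Fintype.card ι : ℝ) * Fintype.card κ * B * CP * CQ *
          ∑ t : Tor M, Real.exp (-(δ * torusSupNorm M (rep M t - y))) * Real.exp (-(δ * torusSupNorm M (rep M t - y'))) := by
        rw [sum_blockConst M (fun z => Real.exp (-(δ * torusSupNorm M (z - y))) * Real.exp (-(δ * torusSupNorm M (z - y'))))]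
    _ ≤ (Fintype.card ι : ℝ) * Fintype.card κ * B * CP * CQ * (latticeConst (d + 1) (δ / 2) * Real.exp (-(δ / 2 * torusSupNorm M (y - y')))) :=
        mul_le_mul_of_nonneg_left (sum_exp_two_centre_le M hδ y y') hK
    _ = _ := by ring

end Decay

/-! ## §3 The one-step clause (general `N, R`) -/

section Step

variable {N R : ℕ} [NeZero N] [NeZero R] (M : Fin (d + 1) → ℕ) [hM : ∀ μ, NeZero (M μ)]

/-- the complex child sum: `Σ_{x′} (RN)^{−(d+1)}·G(par x′) = Σ_x N^{−(d+1)}·G(x)`. [folklore] -/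
theorem sum_child_par_complex (G : Tor (fine N M) → ℂ) :
    ∑ x' : Tor (fine (R * N) M), ((((((R * N : ℕ) : ℝ)) ^ (d + 1))⁻¹ : ℝ) : ℂ) * G (par N R M x')
      = ∑ x : Tor (fine N M), (((((N : ℕ) : ℝ) ^ (d + 1))⁻¹ : ℝ) : ℂ) * G x := by
  have hR : ((R : ℂ)) ≠ 0 := by exact_mod_cast NeZero.ne R
  have hN : ((N : ℕ) : ℂ) ≠ 0 := by exact_mod_cast NeZero.ne N
  rw [← Finset.mul_sum, ← Finset.mul_sum]
  have htile : ∑ x' : Tor (fine (R * N) M), G (par N R M x') = (R : ℂ) ^ (d + 1) * ∑ x : Tor (fine N M), G x := by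
    rw [← Fintype.sum_equiv (tileEquiv N R M) (fun p => G (par N R M (tileEquiv N R M p))) (fun x' => G (par N R M x')) (fun _ => rfl),
      Fintype.sum_prod_type]
    simp only [tileEquiv, Equiv.coe_fn_mk, par_cpt_add_off, Finset.sum_const, Finset.card_univ, Fintype.card_pi, Fintype.card_fin,
      Finset.prod_const, nsmul_eq_mul]
    rw [Finset.mul_sum]
    refine Finset.sum_congr rfl fun x _ => ?_
    push_cast; ring
  rw [htile, ← mul_assoc]
  congr 1
  push_cast
  rw [mul_pow, mul_inv]
  field_simp

/-- the Leibniz bound at one fine point. [folklore] -/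
theorem norm_vertex_sub_le (P' : Tor (fine (R * N) M) → ι → Src M → ℂ) (P : Tor (fine N M) → ι → Src M → ℂ)
    (Q' : Tor (fine (R * N) M) → κ → Src M → ℂ) (Q : Tor (fine N M) → κ → Src M → ℂ)
    (m' : Tor (fine (R * N) M) → ι → κ → ℂ) (m : Tor (fine N M) → ι → κ → ℂ)
    {B CP CQ ρP ρQ εm δ : ℝ} (hB : 0 ≤ B) (hCP : 0 ≤ CP) (hρP : 0 ≤ ρP) (hε : 0 ≤ εm)
    (x' : Tor (fine (R * N) M)) (y y' : Fin (d + 1) → ℤ) (lam lam' : Fin (d + 1))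
    (hm' : ∀ i j, ‖m' x' i j‖ ≤ B) (hm : ∀ i j, ‖m (par N R M x') i j‖ ≤ B) (htr : ∀ i j, ‖m' x' i j - m (par N R M x') i j‖ ≤ εm)
    (hP : ∀ i, ‖P (par N R M x') i (toT M y, lam)‖ ≤ CP * Real.exp (-(δ * torusSupNorm M (rep M (blockOf (R * N) M x') - y))))
    (hQ' : ∀ j, ‖Q' x' j (toT M y', lam')‖ ≤ CQ * Real.exp (-(δ * torusSupNorm M (rep M (blockOf (R * N) M x') - y'))))
    (hdP : ∀ i, ‖P' x' i (toT M y, lam) - P (par N R M x') i (toT M y, lam)‖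
      ≤ ρP * Real.exp (-(δ * torusSupNorm M (rep M (blockOf (R * N) M x') - y))))
    (hdQ : ∀ j, ‖Q' x' j (toT M y', lam') - Q (par N R M x') j (toT M y', lam')‖
      ≤ ρQ * Real.exp (-(δ * torusSupNorm M (rep M (blockOf (R * N) M x') - y')))) :
    ‖∑ i : ι, ∑ j : κ, (m' x' i j * P' x' i (toT M y, lam) * Q' x' j (toT M y', lam')
        - m (par N R M x') i j * P (par N R M x') i (toT M y, lam) * Q (par N R M x') j (toT M y', lam'))‖
      ≤ (Fintype.card ι : ℝ) * Fintype.card κ * (ρP * B * CQ + CP * εm * CQ + CP * B * ρQ)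
          * (Real.exp (-(δ * torusSupNorm M (rep M (blockOf (R * N) M x') - y)))
              * Real.exp (-(δ * torusSupNorm M (rep M (blockOf (R * N) M x') - y')))) := by
  set E := Real.exp (-(δ * torusSupNorm M (rep M (blockOf (R * N) M x') - y)))
  set E' := Real.exp (-(δ * torusSupNorm M (rep M (blockOf (R * N) M x') - y')))
  have hE : 0 ≤ E := (Real.exp_pos _).le
  have hE' : 0 ≤ E' := (Real.exp_pos _).le
  have hterm : ∀ i j, ‖m' x' i j * P' x' i (toT M y, lam) * Q' x' j (toT M y', lam')
        - m (par N R M x') i j * P (par N R M x') i (toT M y, lam) * Q (par N R M x') j (toT M y', lam')‖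
      ≤ (ρP * B * CQ + CP * εm * CQ + CP * B * ρQ) * (E * E') := by
    intro i j
    set a' := m' x' i j; set a := m (par N R M x') i j
    set b' := P' x' i (toT M y, lam); set b := P (par N R M x') i (toT M y, lam)
    set c' := Q' x' j (toT M y', lam'); set c := Q (par N R M x') j (toT M y', lam')
    have e : a' * b' * c' - a * b * c = (b' - b) * a' * c' + b * (a' - a) * c' + b * a * (c' - c) := by ring
    rw [e]
    have h1 : ‖(b' - b) * a' * c'‖ ≤ (ρP * E) * B * (CQ * E') := by
      rw [norm_mul, norm_mul]
      exact mul_le_mul (mul_le_mul (hdP i) (hm' i j) (norm_nonneg _) (mul_nonneg hρP hE)) (hQ' j) (norm_nonneg _)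
        (mul_nonneg (mul_nonneg hρP hE) hB)
    have h2 : ‖b * (a' - a) * c'‖ ≤ (CP * E) * εm * (CQ * E') := by
      rw [norm_mul, norm_mul]
      exact mul_le_mul (mul_le_mul (hP i) (htr i j) (norm_nonneg _) (mul_nonneg hCP hE)) (hQ' j) (norm_nonneg _)
        (mul_nonneg (mul_nonneg hCP hE) hε)
    have h3 : ‖b * a * (c' - c)‖ ≤ (CP * E) * B * (ρQ * E') := by
      rw [norm_mul, norm_mul]
      exact mul_le_mul (mul_le_mul (hP i) (hm i j) (norm_nonneg _) (mul_nonneg hCP hE)) (hdQ j) (norm_nonneg _)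
        (mul_nonneg (mul_nonneg hCP hE) hB)
    calc _ ≤ ‖(b' - b) * a' * c'‖ + ‖b * (a' - a) * c'‖ + ‖b * a * (c' - c)‖ := norm_add₃_le
      _ ≤ (ρP * E) * B * (CQ * E') + (CP * E) * εm * (CQ * E') + (CP * E) * B * (ρQ * E') := add_le_add (add_le_add h1 h2) h3
      _ = _ := by ring
  calc _ ≤ ∑ i : ι, ‖∑ j : κ, (m' x' i j * P' x' i (toT M y, lam) * Q' x' j (toT M y', lam')
          - m (par N R M x') i j * P (par N R M x') i (toT M y, lam) * Q (par N R M x') j (toT M y', lam'))‖ := norm_sum_le _ _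
    _ ≤ ∑ i : ι, ∑ j : κ, ‖m' x' i j * P' x' i (toT M y, lam) * Q' x' j (toT M y', lam')
          - m (par N R M x') i j * P (par N R M x') i (toT M y, lam) * Q (par N R M x') j (toT M y', lam')‖ :=
        Finset.sum_le_sum fun i _ => norm_sum_le _ _
    _ ≤ ∑ _i : ι, ∑ _j : κ, (ρP * B * CQ + CP * εm * CQ + CP * B * ρQ) * (E * E') :=
        Finset.sum_le_sum fun i _ => Finset.sum_le_sum fun j _ => hterm i j
    _ = _ := by simp only [Finset.sum_const, Finset.card_univ, nsmul_eq_mul]; ring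

/-- **THE ONE-STEP CLAUSE OF THE ABSTRACT TWO-LEG CHAIN** (every torus, every `N, R ≥ 1`, `δ > 0`): legs with block decay `CP, CQ` (coarse leg
`P` read at `par x′`, fine leg `Q′` at `x′`) and PARENT LAWS `ρP, ρQ`, vertex bounded by `B` at both levels with transport `εm` ⇒
`‖K′(y,λ;y′,λ′) − K(y,λ;y′,λ′)‖ ≤ |ι|·|κ|·(ρP·B·CQ + CP·εm·CQ + CP·B·ρQ)·latticeConst(d+1,δ∕2)·e^{−(δ∕2)|y−y′|_T}`.
[cite: King1986, §4 p.672 (the Leibniz «successively replace each factor» mechanism), p.664 (parent map)] [folklore] -/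
theorem norm_chain2_succ_sub_le (P' : Tor (fine (R * N) M) → ι → Src M → ℂ) (P : Tor (fine N M) → ι → Src M → ℂ)
    (Q' : Tor (fine (R * N) M) → κ → Src M → ℂ) (Q : Tor (fine N M) → κ → Src M → ℂ)
    (m' : Tor (fine (R * N) M) → ι → κ → ℂ) (m : Tor (fine N M) → ι → κ → ℂ)
    {B CP CQ ρP ρQ εm δ : ℝ} (hδ : 0 < δ) (hB : 0 ≤ B) (hCP : 0 ≤ CP) (hCQ : 0 ≤ CQ) (hρP : 0 ≤ ρP) (hρQ : 0 ≤ ρQ) (hε : 0 ≤ εm)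
    (hm' : ∀ x i j, ‖m' x i j‖ ≤ B) (hm : ∀ x i j, ‖m x i j‖ ≤ B) (htr : ∀ x' i j, ‖m' x' i j - m (par N R M x') i j‖ ≤ εm)
    (hP : ∀ (x' : Tor (fine (R * N) M)) i (y : Fin (d + 1) → ℤ) lam,
      ‖P (par N R M x') i (toT M y, lam)‖ ≤ CP * Real.exp (-(δ * torusSupNorm M (rep M (blockOf (R * N) M x') - y))))
    (hQ' : ∀ (x' : Tor (fine (R * N) M)) j (y : Fin (d + 1) → ℤ) lam,
      ‖Q' x' j (toT M y, lam)‖ ≤ CQ * Real.exp (-(δ * torusSupNorm M (rep M (blockOf (R * N) M x') - y))))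
    (hdP : ∀ (x' : Tor (fine (R * N) M)) i (y : Fin (d + 1) → ℤ) lam,
      ‖P' x' i (toT M y, lam) - P (par N R M x') i (toT M y, lam)‖ ≤ ρP * Real.exp (-(δ * torusSupNorm M (rep M (blockOf (R * N) M x') - y))))
    (hdQ : ∀ (x' : Tor (fine (R * N) M)) j (y : Fin (d + 1) → ℤ) lam,
      ‖Q' x' j (toT M y, lam) - Q (par N R M x') j (toT M y, lam)‖ ≤ ρQ * Real.exp (-(δ * torusSupNorm M (rep M (blockOf (R * N) M x') - y))))
    (y y' : Fin (d + 1) → ℤ) (lam lam' : Fin (d + 1)) :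
    ‖chain2 (R * N) M P' Q' m' (toT M y, lam) (toT M y', lam') - chain2 N M P Q m (toT M y, lam) (toT M y', lam')‖
      ≤ (Fintype.card ι : ℝ) * Fintype.card κ * (ρP * B * CQ + CP * εm * CQ + CP * B * ρQ) * latticeConst (d + 1) (δ / 2)
          * Real.exp (-(δ / 2 * torusSupNorm M (y - y'))) := by
  have hn' : (0 : ℝ) < (((R * N : ℕ) : ℝ)) ^ (d + 1) := by have := Nat.pos_of_ne_zero (NeZero.ne (R * N)); positivity
  have hK : 0 ≤ (Fintype.card ι : ℝ) * Fintype.card κ * (ρP * B * CQ + CP * εm * CQ + CP * B * ρQ) := by positivity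
  set G : Tor (fine N M) → ℂ := fun x => ∑ i : ι, ∑ j : κ, m x i j * P x i (toT M y, lam) * Q x j (toT M y', lam') with hG
  have hcoarse : chain2 N M P Q m (toT M y, lam) (toT M y', lam')
      = ∑ x' : Tor (fine (R * N) M), ((((((R * N : ℕ) : ℝ)) ^ (d + 1))⁻¹ : ℝ) : ℂ) * G (par N R M x') := by
    unfold chain2; rw [sum_child_par_complex M G]
  rw [hcoarse]
  unfold chain2
  rw [← Finset.sum_sub_distrib]
  calc _ ≤ ∑ x' : Tor (fine (R * N) M), ‖((((((R * N : ℕ) : ℝ)) ^ (d + 1))⁻¹ : ℝ) : ℂ) *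
            ∑ i : ι, ∑ j : κ, m' x' i j * P' x' i (toT M y, lam) * Q' x' j (toT M y', lam')
          - ((((((R * N : ℕ) : ℝ)) ^ (d + 1))⁻¹ : ℝ) : ℂ) * G (par N R M x')‖ := norm_sum_le _ _
    _ ≤ ∑ x' : Tor (fine (R * N) M), ((((R * N : ℕ) : ℝ)) ^ (d + 1))⁻¹ *
          ((Fintype.card ι : ℝ) * Fintype.card κ * (ρP * B * CQ + CP * εm * CQ + CP * B * ρQ) *
            (Real.exp (-(δ * torusSupNorm M (rep M (blockOf (R * N) M x') - y)))
              * Real.exp (-(δ * torusSupNorm M (rep M (blockOf (R * N) M x') - y'))))) := by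
        refine Finset.sum_le_sum fun x' _ => ?_
        rw [← mul_sub, norm_mul, Complex.norm_real, Real.norm_of_nonneg (inv_nonneg.mpr hn'.le)]
        refine mul_le_mul_of_nonneg_left ?_ (inv_nonneg.mpr hn'.le)
        rw [hG]
        dsimp only
        rw [← Finset.sum_sub_distrib]
        simp_rw [← Finset.sum_sub_distrib]
        exact norm_vertex_sub_le M P' P Q' Q m' m hB hCP hρP hε x' y y' lam lam' (hm' x') (hm _) (htr x')
          (fun i => hP x' i y lam) (fun j => hQ' x' j y' lam') (fun i => hdP x' i y lam) (fun j => hdQ x' j y' lam')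
    _ = (Fintype.card ι : ℝ) * Fintype.card κ * (ρP * B * CQ + CP * εm * CQ + CP * B * ρQ) *
          ∑ x' : Tor (fine (R * N) M), ((((R * N : ℕ) : ℝ)) ^ (d + 1))⁻¹ *
            (Real.exp (-(δ * torusSupNorm M (rep M (blockOf (R * N) M x') - y)))
              * Real.exp (-(δ * torusSupNorm M (rep M (blockOf (R * N) M x') - y')))) := by
        rw [Finset.mul_sum]; refine Finset.sum_congr rfl fun x _ => ?_; ring
    _ = (Fintype.card ι : ℝ) * Fintype.card κ * (ρP * B * CQ + CP * εm * CQ + CP * B * ρQ) *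
          ∑ t : Tor M, Real.exp (-(δ * torusSupNorm M (rep M t - y))) * Real.exp (-(δ * torusSupNorm M (rep M t - y'))) := by
        rw [sum_blockConst M (fun z => Real.exp (-(δ * torusSupNorm M (z - y))) * Real.exp (-(δ * torusSupNorm M (z - y'))))]
    _ ≤ (Fintype.card ι : ℝ) * Fintype.card κ * (ρP * B * CQ + CP * εm * CQ + CP * B * ρQ) *
          (latticeConst (d + 1) (δ / 2) * Real.exp (-(δ / 2 * torusSupNorm M (y - y')))) :=
        mul_le_mul_of_nonneg_left (sum_exp_two_centre_le M hδ y y') hK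
    _ = _ := by ring

end Step

end Summit.QuantumFields.BalabanUV.Beta.GAN24.TwoLegChainKing

end
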